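import Literature.AlgebraicGeometry.Frobenioids.IrreducibleMorphisms
import Literature.AlgebraicGeometry.Frobenioids.CoAngularPreSteps
import Literature.AlgebraicGeometry.Frobenioids.PreFrobenioidPullbacks
import Literature.AlgebraicGeometry.Frobenioids.FSMIMorphisms
import HarnessLib

/-!
# Frobenioids I, Proposition 1.14 (Irreducible Morphisms), part (ii): pre-steps via FSMI-morphisms

Mochizuki, *The geometry of Frobenioids I: the general theory*, Kyushu J. Math. **62** (2008)
293–400, §1, Proposition 1.14 (ii) and its proof, kurims text pp. 41–42
[cite: MochizukiFrdI2008, Prop. 1.14]. Standing data: `Φ` a divisorial monoid on a connected,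
totally epimorphic category `D`; `C → F_Φ` a Frobenioid (`hF`) of isotropic type (`hist`); `D` of
FSMFF-type (`hD`).

> "(ii) `φ` is a pre-step if and only if it is an FSM-morphism that is mid-adjoint [cf. §0] to
> the irreducible morphisms which are not pre-steps."

PROVED along the printed proof (p. 42). Necessity: Prop. 1.11 (vii) (co-angular pre-steps are
FSM-morphisms; every pre-step is co-angular in a Frobenioid of isotropic type, Prop. 1.4 (i)) and
Prop. 1.7 (v). Sufficiency: write `φ = α ∘ β ∘ γ` (Def. 1.3 (iv)(a)); `γ` is an isomorphism since
otherwise a prime-Frobenius factor of `γ` (Def. 1.3 (ii), Prop. 1.10 (iv)) would be a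
subordinate irreducible non-pre-step; `α` is fiberwise-surjective (formally) and a monomorphism —
here we use the square property of Prop. 1.11 (vii) for the co-angular pre-step `β ∘ γ` (twice)
in place of the text's divisor bookkeeping "adding the pull-backs of `β_*(Div β)`" — hence
`Base(α)` is an FSM-morphism of `D` (Prop. 1.11 (vi)); if `α` were not an isomorphism, condition
(a) of "FSMFF-type" would give a subordinate FSMI-morphism of `Base(α)`, which lifts
(Def. 1.3 (i)(c), Prop. 1.11 (vi)) to a subordinate FSMI pull-back morphism of `φ` that is not a
pre-step — contradicting mid-adjointness. (The statement is proved outright as a theorem; no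
separate named statement of (ii) exists in the tree — the draft `IrreducibleMorphismsCriteria.lean`
mentioned in earlier versions of this docstring was withdrawn unfiled, referee finding I4-F1.)

Renderings (recorded for the referee): composition is diagrammatic; "mid-adjoint to the
irreducible morphisms which are not pre-steps" is `IsMidAdjoint` for the class
`fun ψ => IsIrreducibleHom ψ ∧ ¬ IsPreStep F ψ`. No statement of the paper is strengthened.
-/

namespace Literature.AlgebraicGeometry.Frobenioids

open CategoryTheory Opposite

universe w v v' u u'

namespace PreFrobenioid

variable {D : Type u} [Category.{v} D] {Φ : Dᵒᵖ ⥤ CommMonCat.{w}}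
  {C : Type u'} [Category.{v'} C] (F : C ⥤ ElemFrobenioid Φ)

/-! ### Proposition 1.14 (ii), necessity -/

/-- **Prop. 1.14 (ii)**, necessity: in a Frobenioid of isotropic type a pre-step is an
FSM-morphism [Prop. 1.11 (vii)] mid-adjoint to the irreducible non-pre-steps [Prop. 1.7 (v): all
factors of a pre-step are pre-steps]. [cite: MochizukiFrdI2008, Prop. 1.14(ii) p.42] -/
theorem IsPreStep.isFSM_and_isMidAdjoint (hF : IsFrobenioid F) (hist : IsOfIsotropicType F)
    {A B : C} {φ : A ⟶ B} (hφ : IsPreStep F φ) :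
    IsFSM φ ∧ IsMidAdjoint (fun _ _ ψ => IsIrreducibleHom ψ ∧ ¬ IsPreStep F ψ) φ := by
  have hD := hF.isPreFrobenioid.isTotallyEpimorphic_base
  refine ⟨IsCoAngularPreStep.isFSM hF ⟨isCoAngular_of_isOfIsotropicType F hist φ, hφ⟩,
    fun X Y γ β α hfac hβ => ?_⟩
  have h1 : IsPreStep F (β ≫ α) := (isPreStep_factors F hD (hfac.symm ▸ hφ)).1
  exact (hβ.2 (isPreStep_factors F hD h1).2).elim

/-! ### Proposition 1.14 (ii), sufficiency -/

/-- A morphism of Frobenius type which is not an isomorphism has a subordinate prime-Frobenius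
(first) factor (Def. 1.3 (ii), Prop. 1.10 (iv)/(v)). [cite: MochizukiFrdI2008, Prop. 1.14(ii) p.42] -/
theorem exists_primeFrobenius_fac_of_isFrobeniusType (hF : IsFrobenioid F) {A B : C} {γ : A ⟶ B}
    (hγ : IsFrobeniusType F γ) (hne : ¬ IsIso γ) :
    ∃ (X : C) (μ : A ⟶ X) (ν : X ⟶ B), μ ≫ ν = γ ∧ IsPrimeFrobenius F μ := by
  have hd : (degFr F γ : ℕ) ≠ 1 := fun h =>
    hne (isIso_of_isFrobeniusType_of_degFr_eq_one hF hγ (PNat.coe_inj.mp (by simpa using h)))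
  obtain ⟨p, hp, k, hk⟩ := Nat.exists_prime_and_dvd hd
  have hkpos : 0 < k := Nat.pos_of_ne_zero (by rintro rfl; simp at hk)
  obtain ⟨X, μ, ν, hfac, hμ, hμd, -, -⟩ := exists_split_of_isFrobeniusType hF hγ ⟨p, hp.pos⟩
    ⟨k, hkpos⟩ (PNat.eq (by simpa using hk))
  exact ⟨X, μ, ν, hfac, hμ, by rw [hμd]; exact hp⟩

/-- In a Frobenioid of isotropic type: if `φ = α ∘ β` with `β` a pre-step and `φ` a monomorphism,
then `α` is a monomorphism (via the square property of Prop. 1.11 (vii) for the co-angular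
pre-step `β`, applied twice, and total epimorphicity).
[cite: MochizukiFrdI2008, Prop. 1.14(ii) p.42] -/
theorem mono_of_preStep_comp_mono (hF : IsFrobenioid F) (hist : IsOfIsotropicType F)
    {A Y B : C} {β : A ⟶ Y} {α : Y ⟶ B} (hβ : IsPreStep F β) [Mono (β ≫ α)] : Mono α := by
  have hC := hF.isPreFrobenioid.isTotallyEpimorphic
  have hβc : IsCoAngularPreStep F β := ⟨isCoAngular_of_isOfIsotropicType F hist β, hβ⟩
  refine ⟨fun {Z} ε₁ ε₂ heq => ?_⟩
  obtain ⟨W₁, γ₁, a₁, _, hsq₁⟩ := exists_coAngular_square hF β hβc ε₁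
  obtain ⟨W₂, γ₂, a₂, _, hsq₂⟩ := exists_coAngular_square hF β hβc (γ₁ ≫ ε₂)
  -- `hsq₁ : γ₁ ≫ ε₁ = a₁ ≫ β`, `hsq₂ : γ₂ ≫ γ₁ ≫ ε₂ = a₂ ≫ β`
  have h1 : (γ₂ ≫ a₁) ≫ β ≫ α = a₂ ≫ β ≫ α := by
    calc (γ₂ ≫ a₁) ≫ β ≫ α = γ₂ ≫ (a₁ ≫ β) ≫ α := by simp only [Category.assoc]
      _ = γ₂ ≫ (γ₁ ≫ ε₁) ≫ α := by rw [hsq₁]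
      _ = γ₂ ≫ γ₁ ≫ (ε₂ ≫ α) := by rw [Category.assoc, heq]
      _ = (γ₂ ≫ γ₁ ≫ ε₂) ≫ α := by simp only [Category.assoc]
      _ = (a₂ ≫ β) ≫ α := by rw [hsq₂]
      _ = a₂ ≫ β ≫ α := Category.assoc _ _ _
  have h2 : γ₂ ≫ a₁ = a₂ := (cancel_mono (β ≫ α)).mp h1
  haveI := hC.epi γ₁
  haveI := hC.epi γ₂
  rw [← cancel_epi γ₁, ← cancel_epi γ₂, hsq₁, ← Category.assoc γ₂ a₁, h2, hsq₂]

/-- **Prop. 1.14 (ii)**, sufficiency: in a Frobenioid of isotropic type over a base category of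
FSMFF-type, an FSM-morphism mid-adjoint to the irreducible non-pre-steps is a pre-step.
[cite: MochizukiFrdI2008, Prop. 1.14(ii) p.42] -/
theorem isPreStep_of_isFSM_isMidAdjoint (hF : IsFrobenioid F) (hist : IsOfIsotropicType F)
    (hD : IsOfFSMFFType D) {A B : C} {φ : A ⟶ B} (hfsm : IsFSM φ)
    (hmid : IsMidAdjoint (fun _ _ ψ => IsIrreducibleHom ψ ∧ ¬ IsPreStep F ψ) φ) :
    IsPreStep F φ := by
  obtain ⟨X, Y, γ, β, α, hcomp, hγ, hβ, hα⟩ := hF.iv_a_exists φ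
  -- Step 1: `γ` is an isomorphism (otherwise a prime-Frobenius factor of `γ` is a subordinate
  -- irreducible non-pre-step)
  haveI : IsIso γ := by
    by_contra hne
    obtain ⟨X₁, μ, ν, hμν, hμ⟩ := exists_primeFrobenius_fac_of_isFrobeniusType F hF hγ hne
    have hirr : IsIrreducibleHom μ := hμ.isIrreducibleHom hF (hist A)
    have hnps : ¬ IsPreStep F μ := fun h => by
      have h1 : (degFr F μ : ℕ) = 1 := by rw [show degFr F μ = 1 from h.1]; rfl
      exact (Nat.Prime.one_lt hμ.2).ne' h1
    have := hmid (𝟙 A) μ (ν ≫ β ≫ α) (by rw [Category.id_comp, reassoc_of% hμν, hcomp])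
      ⟨hirr, hnps⟩
    exact hirr.1 this
  -- the pre-step `β' = β ∘ γ`, `φ = α ∘ β'`
  have hβ' : IsPreStep F (γ ≫ β) := IsPreStep.comp F (isPreStep_of_isIso F γ) hβ
  have hcomp' : (γ ≫ β) ≫ α = φ := by rw [Category.assoc, hcomp]
  -- Step 2: `α` is fiberwise-surjective (formal) and a monomorphism, i.e. an FSM-morphism
  have hαfs : IsFiberwiseSurjective α := fun Z g => by
    obtain ⟨W, δ₁, δ₂, h⟩ := hfsm.1 g
    exact ⟨W, δ₁ ≫ γ ≫ β, δ₂, by simp only [Category.assoc]; rw [hcomp, h]⟩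
  haveI : Mono ((γ ≫ β) ≫ α) := by rw [hcomp']; exact hfsm.2
  have hαm : Mono α := mono_of_preStep_comp_mono F hF hist hβ'
  -- Step 3: `α` is an isomorphism (otherwise `Base(α)`, an FSM-morphism of `D` that is not an
  -- isomorphism, has a subordinate FSMI-morphism, which lifts to a subordinate FSMI pull-back
  -- morphism of `φ` that is not a pre-step)
  haveI : IsIso α := by
    by_contra hne
    have hbfsm : IsFSM (Base F α) := (isFSM_iff_of_isPullbackMorphism hF hα).mp ⟨hαfs, hαm⟩
    have hbne : ¬ IsIso (Base F α) := fun h =>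
      hne ((isPullbackMorphism_and_isBaseIso_iff_isIso F α).mp ⟨hα, h⟩)
    obtain ⟨n, hchain⟩ := hD.factors (Base F α) hbfsm hbne
    obtain ⟨X₀, ψ₀, χ₀, hψ₀, hfac₀⟩ := hchain.exists_fac
    -- lift `χ₀` to a pull-back morphism `χ : X' → B`, then `α` along `χ`
    obtain ⟨X', χ, i, hχ, hχb⟩ := exists_isPullbackMorphism_over hF B χ₀
    obtain ⟨ψ, hψ⟩ := (hχ Y).2 ⟨(α, ψ₀ ≫ i.inv), by
      dsimp only
      rw [hχb, Category.assoc, i.inv_hom_id_assoc, hfac₀]⟩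
    have hψχ : ψ ≫ χ = α := congrArg (fun q : PullbackHomData F χ Y => q.1.1) hψ
    have hψb : Base F ψ = ψ₀ ≫ i.inv := congrArg (fun q : PullbackHomData F χ Y => q.1.2) hψ
    have hψpb : IsPullbackMorphism F ψ := IsPullbackMorphism.of_comp F hχ (hψχ.symm ▸ hα)
    have hψ₀' : IsFSMI (Base F ψ) := by
      rw [hψb]
      exact hψ₀.comp_iso i.symm
    have hirr : IsIrreducibleHom ψ :=
      (isIrreducibleHom_iff_of_isPullbackMorphism hF hψpb).mpr hψ₀'.2
    have hnps : ¬ IsPreStep F ψ := fun h => hψ₀'.2.1 h.2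
    have := hmid (γ ≫ β) ψ χ (by rw [hψχ, hcomp']) ⟨hirr, hnps⟩
    exact hirr.1 this
  -- Step 4: `φ = α ∘ β'` is a pre-step
  rw [← hcomp']
  exact IsPreStep.comp F hβ' (isPreStep_of_isIso F α)

/-- **Prop. 1.14 (ii)**: "`φ` is a pre-step if and only if it is an FSM-morphism that is
mid-adjoint to the irreducible morphisms which are not pre-steps" — in a Frobenioid of
isotropic type over a base category of FSMFF-type. [cite: MochizukiFrdI2008, Prop. 1.14(ii) p.41] -/
theorem isPreStep_iff_isFSM_and_isMidAdjoint (hF : IsFrobenioid F) (hist : IsOfIsotropicType F)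
    (hD : IsOfFSMFFType D) {A B : C} (φ : A ⟶ B) :
    IsPreStep F φ ↔ IsFSM φ ∧ IsMidAdjoint (fun _ _ ψ => IsIrreducibleHom ψ ∧ ¬ IsPreStep F ψ) φ :=
  ⟨fun h => h.isFSM_and_isMidAdjoint F hF hist,
    fun h => isPreStep_of_isFSM_isMidAdjoint F hF hist hD h.1 h.2⟩

end PreFrobenioid

end Literature.AlgebraicGeometry.Frobenioids
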